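import Summits.CriticalPhenomena.PercolationContinuityZ3.Theorems.FK.InfiniteVolumeMeasures
import HarnessLib

/-!
# FK-continuity transplant, FO-06 (construction half): the box laws under automorphisms of `ℤ^d` —
# transport of "all of `E₀` open" and the sandwich of shifted boxes

Cell `fk-continuity` (bschramm), row FO-06 seat B; support file for the FK-continuity transplant
(`--supports stmt-CriticalPhenomena-4575`); builds on p205010 (kernel theorem, internal audit signed;
external expert review pending). No named facts, no sorries, standard axioms. General dimension `d`.

Finite-volume inputs for the automorphism invariance of the box limits (Grimmett 2006,
Thm. (4.19)(b); `InfiniteVolumeInvariance.lean`), both boundary conditions: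

* transport of the increasing cylinder "all pairs of `E₀` open" on finite pieces `S → g(S)` under
  an automorphism `g` of `ℤ^d` and **automorphism invariance of the finite-volume probabilities**
  `φ^b_S(E₀ open) = φ^b_{g S}(g E₀ open)` (`rcMeasure_real_iInter_eOpen_eq_of_iso`; the tree's
  `rcMeasure_real_preimage_relabel` with `finsetGraphIso`, the wired boundary being carried onto
  the wired boundary, `image_finsetGraphIso_wiredBoundary`);
* **monotonicity in the domain** for these events (Grimmett's (4.24)): free measures increase
  along finite pieces `Λ ⊆ Δ` (`rcMeasure_real_iInter_eOpen_free_mono`), wired measures decrease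
  along nested coordinate boxes (`rcMeasure_real_iInter_eOpen_wired_anti`, `d ≥ 1`);
* **translations**: `φ^b_{Λ_N}((E₀ + v) open) = φ^b_{Λ_N - v}(E₀ open)`
  (`rcBoxLaw_real_setOf_shift_subset`) and the sandwich `Λ_{N-‖v‖} ⊆ Λ_N - v ⊆ Λ_{N+‖v‖}`:
  `φ⁰_{Λ_{N-‖v‖}}(E₀ open) ≤ φ⁰_{Λ_N}((E₀+v) open) ≤ φ⁰_{Λ_{N+‖v‖}}(E₀ open)` and, reversed,
  `φ¹_{Λ_{N+‖v‖}}(E₀ open) ≤ φ¹_{Λ_N}((E₀+v) open) ≤ φ¹_{Λ_{N-‖v‖}}(E₀ open)`.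

## References

* G. Grimmett, *The Random-Cluster Model*, Springer 2006: §4.3 (automorphisms, translations
  `τ_x`), Thm. (4.19)(a)–(b) and proof (p. 78), eq. (4.24). [Grimmett2006]
-/

noncomputable section

open MeasureTheory Set Filter
open scoped Topology ENNReal

namespace Summit.CriticalPhenomena.PercolationContinuityZ3.Theorems.FK

open Literature.Probability.Percolation Literature.Probability.LatticeModels

variable {d : ℕ}

/-! ### Transport of "all of `E₀` open" on finite pieces under automorphisms of `ℤ^d` -/

/-- Transport of the event "all pairs of `E₀` open" on finite pieces `S → S' = g(S)` under an
automorphism `g` of `ℤ^d`: the preimage of the event for `g(E₀)` on `S'` is the event for `E₀` on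
`S` (the tree's `relabel_preimage_eOpen`, one pair at a time). [cite: Grimmett2006, §4.3 (automorphism invariance)] -/
theorem relabel_preimage_iInter_eOpen (g : zdGraph d ≃g zdGraph d) {S S' : Finset (Site d)}
    (hS : ∀ x, x ∈ S' ↔ g.symm x ∈ S) (E₀ : Finset (Sym2 (Site d))) :
    BondConfig.relabel (sym2Equiv (finsetGraphIso g hS).toEquiv) ⁻¹'
        (⋂ e ∈ E₀, eOpen S' (e.map g)) = ⋂ e ∈ E₀, eOpen S e := by
  rw [Set.preimage_iInter₂]
  exact Set.iInter₂_congr fun e _ => relabel_preimage_eOpen g hS e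

/-- **Automorphism invariance of the finite-volume probabilities of "all of `E₀` open"**, either
boundary condition: `φ^b_S(E₀ open) = φ^b_{g S}(g E₀ open)` for an automorphism `g` of `ℤ^d` with
`S' = g(S)` (the wired boundary `∂S` is carried onto `∂S'`). [cite: Grimmett2006, §4.3 (automorphism invariance)] -/
theorem rcMeasure_real_iInter_eOpen_eq_of_iso (g : zdGraph d ≃g zdGraph d) {S S' : Finset (Site d)}
    (hS : ∀ x, x ∈ S' ↔ g.symm x ∈ S) (b : Bool) {p q : ℝ} (hp : p ∈ Set.Icc (0 : ℝ) 1) (hq : 0 < q)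
    (E₀ : Finset (Sym2 (Site d))) :
    (rcMeasure (finsetGraph (zdGraph d) S) p q (bif b then wiredBoundary (zdGraph d) S else ∅)).real
        (⋂ e ∈ E₀, eOpen S e) =
      (rcMeasure (finsetGraph (zdGraph d) S') p q (bif b then wiredBoundary (zdGraph d) S' else ∅)).real
        (⋂ e ∈ E₀, eOpen S' (e.map g)) := by
  rw [← relabel_preimage_iInter_eOpen g hS E₀,
    rcMeasure_real_preimage_relabel (finsetGraphIso g hS) hp hq]
  cases b
  · simp only [cond_false, Set.image_empty]
  · simp only [cond_true, image_finsetGraphIso_wiredBoundary]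

/-- The box measure with boundary condition `b` is the `bif`-form measure of the piece `Λ_n`.
[folklore] -/
theorem rcBoxMeasure_eq_bif (b : Bool) (p q : ℝ) (n : ℕ) :
    rcBoxMeasure d b p q n = rcMeasure (finsetGraph (zdGraph d) (box d n)) p q
      (bif b then wiredBoundary (zdGraph d) (box d n) else ∅) := rfl

/-- **Monotonicity in the domain for "all of `E₀` open", free** (Grimmett's (4.24)): for finite
pieces `Λ ⊆ Δ` of `ℤ^d` containing the endpoints of the pairs of `E₀`, `0 ≤ p ≤ 1`, `q ≥ 1`,
`φ⁰_Λ(E₀ open) ≤ φ⁰_Δ(E₀ open)`. [cite: Grimmett2006, Thm. (4.19)(a), proof, eq. (4.24)] -/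
theorem rcMeasure_real_iInter_eOpen_free_mono {Λ Δ : Finset (Site d)} (h : Λ ⊆ Δ) {p q : ℝ}
    (hp : p ∈ Set.Icc (0 : ℝ) 1) (hq : 1 ≤ q) {E₀ : Finset (Sym2 (Site d))}
    (hE : ∀ e ∈ E₀, ∀ z ∈ e, z ∈ Λ) :
    (rcMeasure (finsetGraph (zdGraph d) Λ) p q ∅).real (⋂ e ∈ E₀, eOpen Λ e) ≤
      (rcMeasure (finsetGraph (zdGraph d) Δ) p q ∅).real (⋂ e ∈ E₀, eOpen Δ e) := by
  rw [← finsetRestrict_preimage_iInter_eOpen h hE]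
  exact rcMeasure_real_free_le_restrict h hp hq (isUpperSet_iInter_eOpen Λ E₀)

/-- **Monotonicity in the domain for "all of `E₀` open", wired** ((4.24) reversed): for nested
coordinate boxes `Icc a b ⊆ Icc a' b'` of `ℤ^d` (`d ≥ 1`, `a ≤ b`) containing the endpoints of
the pairs of `E₀`, `0 ≤ p ≤ 1`, `q ≥ 1`, `φ¹_{Icc a' b'}(E₀ open) ≤ φ¹_{Icc a b}(E₀ open)`.
[cite: Grimmett2006, Thm. (4.19)(a), proof, eq. (4.24)] -/
theorem rcMeasure_real_iInter_eOpen_wired_anti (hd : 0 < d) {a b a' b' : Site d} (hab : a ≤ b)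
    (h : Finset.Icc a b ⊆ Finset.Icc a' b') {p q : ℝ} (hp : p ∈ Set.Icc (0 : ℝ) 1) (hq : 1 ≤ q)
    {E₀ : Finset (Sym2 (Site d))} (hE : ∀ e ∈ E₀, ∀ z ∈ e, z ∈ Finset.Icc a b) :
    (rcMeasure (finsetGraph (zdGraph d) (Finset.Icc a' b')) p q
        (wiredBoundary (zdGraph d) (Finset.Icc a' b'))).real (⋂ e ∈ E₀, eOpen (Finset.Icc a' b') e) ≤
      (rcMeasure (finsetGraph (zdGraph d) (Finset.Icc a b)) p q
        (wiredBoundary (zdGraph d) (Finset.Icc a b))).real (⋂ e ∈ E₀, eOpen (Finset.Icc a b) e) := by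
  rw [← finsetRestrict_preimage_iInter_eOpen h hE]
  exact rcMeasure_real_icc_restrict_le h hd hab hp hq (isUpperSet_iInter_eOpen _ E₀)

/-! ### Translations: the sandwich of shifted boxes -/

/-- The pair set `E₀ + v`: the image of `E₀` under the pair bijection of the translation
`Site.shift v` is `E₀` mapped by `e ↦ e.map (· + v)`. [folklore] -/
theorem sym2Equiv_shift_toEmbedding_apply (v : Site d) (e : Sym2 (Site d)) :
    (sym2Equiv (Site.shift v)).toEmbedding e = e.map (· + v) := by
  rw [Equiv.coe_toEmbedding, sym2Equiv_apply]
  rfl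

/-- The box law of "all of `E₀` open" is the box measure of `⋂_{e ∈ E₀} J_e`, for a mapped
pair set. [folklore] -/
theorem rcBoxLaw_real_setOf_map_subset (b : Bool) (p q : ℝ) (n : ℕ) (E₀ : Finset (Sym2 (Site d)))
    (f : Sym2 (Site d) ↪ Sym2 (Site d)) :
    (rcBoxLaw d b p q n).real {ω | (↑(E₀.map f) : Set (Sym2 (Site d))) ⊆ ω} =
      (rcBoxMeasure d b p q n).real (⋂ e ∈ E₀, eOpen (box d n) (f e)) := by
  rw [rcBoxLaw_real_setOf_subset]
  congr 1
  ext ω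
  simp only [Set.mem_iInter, Finset.forall_mem_map]

/-- **`φ^b_{Λ_N}((E₀ + v) open) = φ^b_{Λ_N - v}(E₀ open)`** (automorphism invariance under the
translation `τ_{-v}`). [cite: Grimmett2006, §4.3 and proof of Thm. (4.19)(b)] -/
theorem rcBoxLaw_real_setOf_shift_subset (b : Bool) (v : Site d) {p q : ℝ}
    (hp : p ∈ Set.Icc (0 : ℝ) 1) (hq : 0 < q) (E₀ : Finset (Sym2 (Site d))) (N : ℕ) :
    (rcBoxLaw d b p q N).real
        {ω | (↑(E₀.map (sym2Equiv (Site.shift v)).toEmbedding) : Set (Sym2 (Site d))) ⊆ ω} =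
      (rcMeasure (finsetGraph (zdGraph d)
          (Finset.Icc (fun i => -(N : ℤ) + (-v) i) (fun i => (N : ℤ) + (-v) i))) p q
          (bif b then wiredBoundary (zdGraph d)
            (Finset.Icc (fun i => -(N : ℤ) + (-v) i) (fun i => (N : ℤ) + (-v) i)) else ∅)).real
        (⋂ e ∈ E₀, eOpen (Finset.Icc (fun i => -(N : ℤ) + (-v) i) (fun i => (N : ℤ) + (-v) i)) e) := by
  rw [rcBoxLaw_real_setOf_subset, rcBoxMeasure_eq_bif,
    rcMeasure_real_iInter_eOpen_eq_of_iso (zdShiftIso (-v)) (mem_icc_shift_iff N (-v)) b hp hq]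
  congr 1
  ext ω
  simp only [Set.mem_iInter, Finset.forall_mem_map]
  refine forall₂_congr fun e _ => ?_
  rw [sym2Equiv_shift_toEmbedding_apply, Sym2.map_map]
  have hid : (⇑(zdShiftIso (-v)) ∘ fun x : Site d => x + v) = id := by
    funext x
    simp
  rw [hid, Sym2.map_id, id_eq]

/-- All pairs of `E₀` lie in the box `Λ_n` once `n ≥ sup pairRad E₀ + k` for any `k`. [folklore] -/
theorem forall_mem_box_of_sup_pairRad_add_le {E₀ : Finset (Sym2 (Site d))} {k n : ℕ}
    (hn : E₀.sup pairRad + k ≤ n) : ∀ e ∈ E₀, ∀ z ∈ e, z ∈ box d (n - k) :=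
  fun _ he => mem_box_of_pairRad_le (by have := Finset.le_sup (f := pairRad) he; omega)

/-- Sandwich for the FREE box laws, lower side: `φ⁰_{Λ_{N-‖v‖}}(E₀ open) ≤ φ⁰_{Λ_N}((E₀+v) open)`
once the pairs of `E₀` lie in `Λ_{N-‖v‖}`. [cite: Grimmett2006, Thm. (4.19)(b), proof, via eq. (4.24)] -/
theorem rcBoxLaw_false_real_sub_le_shift (v : Site d) {p q : ℝ} (hp : p ∈ Set.Icc (0 : ℝ) 1)
    (hq : 1 ≤ q) {E₀ : Finset (Sym2 (Site d))} {N : ℕ} (hN : E₀.sup pairRad + siteRad v ≤ N) :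
    (rcBoxLaw d false p q (N - siteRad v)).real {ω | (↑E₀ : Set (Sym2 (Site d))) ⊆ ω} ≤
      (rcBoxLaw d false p q N).real
        {ω | (↑(E₀.map (sym2Equiv (Site.shift v)).toEmbedding) : Set (Sym2 (Site d))) ⊆ ω} := by
  have hq0 : 0 < q := one_pos.trans_le hq
  rw [rcBoxLaw_real_setOf_shift_subset false v hp hq0 E₀ N, rcBoxLaw_real_setOf_subset,
    rcBoxMeasure_false, cond_false]
  have hsub := box_sub_subset_icc_shift (d := d) (n := N) (v := -v) (by rw [siteRad_neg]; omega)
  rw [siteRad_neg] at hsub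
  exact rcMeasure_real_iInter_eOpen_free_mono hsub hp hq (forall_mem_box_of_sup_pairRad_add_le hN)

/-- Sandwich for the FREE box laws, upper side: `φ⁰_{Λ_N}((E₀+v) open) ≤ φ⁰_{Λ_{N+‖v‖}}(E₀ open)`
once the pairs of `E₀ + v` lie in `Λ_N`. [cite: Grimmett2006, Thm. (4.19)(b), proof, via eq. (4.24)] -/
theorem rcBoxLaw_false_real_shift_le_add (v : Site d) {p q : ℝ} (hp : p ∈ Set.Icc (0 : ℝ) 1)
    (hq : 1 ≤ q) {E₀ : Finset (Sym2 (Site d))} {N : ℕ}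
    (hN : (E₀.map (sym2Equiv (Site.shift v)).toEmbedding).sup pairRad ≤ N) :
    (rcBoxLaw d false p q N).real
        {ω | (↑(E₀.map (sym2Equiv (Site.shift v)).toEmbedding) : Set (Sym2 (Site d))) ⊆ ω} ≤
      (rcBoxLaw d false p q (N + siteRad v)).real {ω | (↑E₀ : Set (Sym2 (Site d))) ⊆ ω} := by
  have hq0 : 0 < q := one_pos.trans_le hq
  rw [rcBoxLaw_real_setOf_shift_subset false v hp hq0 E₀ N, rcBoxLaw_real_setOf_subset,
    rcBoxMeasure_false, cond_false]
  have hsub := icc_shift_subset_box_add (d := d) N (-v)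
  rw [siteRad_neg] at hsub
  refine rcMeasure_real_iInter_eOpen_free_mono hsub hp hq fun e he => ?_
  refine mem_icc_neg_shift_of_pairRad_map_add_le ?_
  have h1 : pairRad ((sym2Equiv (Site.shift v)).toEmbedding e) ≤
      (E₀.map (sym2Equiv (Site.shift v)).toEmbedding).sup pairRad :=
    Finset.le_sup (f := pairRad) (Finset.mem_map_of_mem _ he)
  rw [sym2Equiv_shift_toEmbedding_apply] at h1
  exact h1.trans hN

/-- Sandwich for the WIRED box laws (`d ≥ 1`), upper side:
`φ¹_{Λ_N}((E₀+v) open) ≤ φ¹_{Λ_{N-‖v‖}}(E₀ open)` once the pairs of `E₀` lie in `Λ_{N-‖v‖}`.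
[cite: Grimmett2006, Thm. (4.19)(b), proof, via eq. (4.24)] -/
theorem rcBoxLaw_true_real_shift_le_sub (hd : 0 < d) (v : Site d) {p q : ℝ}
    (hp : p ∈ Set.Icc (0 : ℝ) 1) (hq : 1 ≤ q) {E₀ : Finset (Sym2 (Site d))} {N : ℕ}
    (hN : E₀.sup pairRad + siteRad v ≤ N) :
    (rcBoxLaw d true p q N).real
        {ω | (↑(E₀.map (sym2Equiv (Site.shift v)).toEmbedding) : Set (Sym2 (Site d))) ⊆ ω} ≤
      (rcBoxLaw d true p q (N - siteRad v)).real {ω | (↑E₀ : Set (Sym2 (Site d))) ⊆ ω} := by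
  have hq0 : 0 < q := one_pos.trans_le hq
  rw [rcBoxLaw_real_setOf_shift_subset true v hp hq0 E₀ N, rcBoxLaw_real_setOf_subset,
    rcBoxMeasure_true, cond_true, box_eq_Icc']
  have hsub := box_sub_subset_icc_shift (d := d) (n := N) (v := -v) (by rw [siteRad_neg]; omega)
  rw [siteRad_neg, box_eq_Icc'] at hsub
  refine rcMeasure_real_iInter_eOpen_wired_anti hd (fun _ => by simp) hsub hp hq fun e he => ?_
  rw [← box_eq_Icc']
  exact forall_mem_box_of_sup_pairRad_add_le hN e he

/-- Sandwich for the WIRED box laws (`d ≥ 1`), lower side: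
`φ¹_{Λ_{N+‖v‖}}(E₀ open) ≤ φ¹_{Λ_N}((E₀+v) open)` once the pairs of `E₀ + v` lie in `Λ_N`.
[cite: Grimmett2006, Thm. (4.19)(b), proof, via eq. (4.24)] -/
theorem rcBoxLaw_true_real_add_le_shift (hd : 0 < d) (v : Site d) {p q : ℝ}
    (hp : p ∈ Set.Icc (0 : ℝ) 1) (hq : 1 ≤ q) {E₀ : Finset (Sym2 (Site d))} {N : ℕ}
    (hN : (E₀.map (sym2Equiv (Site.shift v)).toEmbedding).sup pairRad ≤ N) :
    (rcBoxLaw d true p q (N + siteRad v)).real {ω | (↑E₀ : Set (Sym2 (Site d))) ⊆ ω} ≤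
      (rcBoxLaw d true p q N).real
        {ω | (↑(E₀.map (sym2Equiv (Site.shift v)).toEmbedding) : Set (Sym2 (Site d))) ⊆ ω} := by
  have hq0 : 0 < q := one_pos.trans_le hq
  rw [rcBoxLaw_real_setOf_shift_subset true v hp hq0 E₀ N, rcBoxLaw_real_setOf_subset,
    rcBoxMeasure_true, cond_true, box_eq_Icc']
  have hsub := icc_shift_subset_box_add (d := d) N (-v)
  rw [siteRad_neg, box_eq_Icc'] at hsub
  refine rcMeasure_real_iInter_eOpen_wired_anti hd (fun i => by simp) hsub hp hq fun e he => ?_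
  refine mem_icc_neg_shift_of_pairRad_map_add_le ?_
  have h1 : pairRad ((sym2Equiv (Site.shift v)).toEmbedding e) ≤
      (E₀.map (sym2Equiv (Site.shift v)).toEmbedding).sup pairRad :=
    Finset.le_sup (f := pairRad) (Finset.mem_map_of_mem _ he)
  rw [sym2Equiv_shift_toEmbedding_apply] at h1
  exact h1.trans hN

end Summit.CriticalPhenomena.PercolationContinuityZ3.Theorems.FK

end
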